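/-
COR-CM (cell pub-hodgecm2, stage 2 of the Hodge ladder) — Δ2 BRIDGE, the ι₁ ∕ ῑ₁ instance seam of the (c)+(d) residual
(ASSEMBLER DECISIONS #13 ∕ #14, sub-socket S-c «conjugation transport»).  Seat prover-pub-hodgecm2-d2bridge-wb-1-g0-0 (WALL-BREAKER 1).
THE PART OF THE CONJUGATION TRANSPORT THAT EXISTS: complex-conjugate base changes of an `L`-scheme have canonically
homeomorphic complex points and hence canonically isomorphic Betti cohomology, compatibly with base-changed `L`-morphisms.
Pure bookkeeping over the tree's `AlgPoints` ∕ `baseChangeEquiv` ∕ `bettiCohomology`; no definition of a mathematical notion,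
no named fact, no `sorry`, no new axiom; nothing landed is edited or restated.  FRAMING: HC_CM is NOT proved; «Δ2 BRIDGE CLOSED»
is NOT claimed; this file discharges NO binder of any END display (see «What this does NOT do» below).
-/
import Literature.AlgebraicGeometry.Motives.BaseChangePointsProofs
import Literature.AlgebraicGeometry.Motives.BettiRealization
import Literature.AlgebraicGeometry.Motives.AbelianVarietyBaseChange
import Literature.AlgebraicGeometry.HodgeTheory.BettiUniverseAxioms
import HarnessLib

/-!
# Δ2 bridge, conjugation transport (S-c): complex points and Betti cohomology of conjugate base changes

For a field `L`, an `L`-scheme `Y`, a field `F` with a ring automorphism `σ : F ≃+* F` and two embeddings `ι ι' : L →+* F`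
with `ι' = σ ∘ ι` (the case of record: `F = ℂ`, `σ = conj`, `ι' = ῑ := (starRingEnd ℂ).comp ι`):

* §1 `specTwist` — `Spec σ` as an `L`-morphism `Spec_{ι'} F ⟶ Spec_ι F`; `twist` — precomposition with it,
  `Y(F via ι) → Y(F via ι')` on `F`-points (`P ↦ Spec σ ≫ P`); `twist_twist` (an involution up to `σ ↦ σ⁻¹`), `twistEquiv`;
  `pt_twist` (same underlying point of `Y`), `eval_twist` (`f(twist P) = σ (f P)` on regular functions), hence
  `continuous_twist` for a continuous `σ` and the homeomorphism `twistHomeomorph`; `twist_comp` (naturality in `Y`).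
* §2 `baseChangeEquiv_comp` — the tree's `X(F) ≃ X_ι(F)` (`AlgPoints.baseChangeEquiv`) is natural in `X`.
* §3 `conjPoints ι ι' σ h Y : (Y_ι)(F) ≃ₜ (Y_{ι'})(F)` — complex points of the two base changes `Y ×_{L,ι} F`, `Y ×_{L,ι'} F`
  (objects of `SchemeOver F`) are canonically homeomorphic (`baseChangeEquiv` on both sides, a homeomorphism by the tree's
  `isHomeomorph_baseChangeEquiv_holds`, and `twistHomeomorph` in the middle); `conjPoints_natural`.
* §4 `bettiConjIso ι Y k : Hᵏ_B(Y_ι) ≅ Hᵏ_B(Y_ῑ)` for `F = ℂ`, `σ = conj` — rational Betti cohomology of the two complexifications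
  is canonically isomorphic, and `bettiConjIso_natural`: the isomorphism intertwines `bettiCohomology.map ((baseChangeHom ι).map f)`
  with `bettiCohomology.map ((baseChangeHom ῑ).map f)` for every `L`-morphism `f`.
* §5 the abelian-variety currency of the J-record ∕ S1 files (`(A.baseChange ℂ).X` under `letI := ι.toAlgebra`, pull-backs along
  `AbelianVariety.Hom.baseChange ℂ φ`): `baseChange_X_eq` (`rfl`) and `bettiConjLinearEquiv_pull`.

## What this does NOT do (the S-c census; ORIENTATION-MEMO v1.3, DECISION #14)
The interface `ComponentAlbanese … C T` (`CorCM/D2Bridge/ComponentAlbanese.lean` :80) has the SAME sources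
`Var.scheme hU h₃ (.pms (pmsCode L ι₁ V _))` under the instances `ι₁.toAlgebra` and `ῑ₁.toAlgebra` and complex-CONJUGATE targets
`((C.A K).baseChange ℂ).X`; an honest value exists only at `ῑ₁` (✔ `AlbaneseOnPieceCofan` :181).  The present file shows what IS
canonical between the two targets — their complex points and their `H¹(−; ℚ)` — and by omission what is not: there is no
`ℂ`-morphism between them (they are conjugate complex varieties), so no transport of the field `alb`; and the Hodge type of a class
is REVERSED under `bettiConjIso` ((p,q) ↦ (q,p); not formalised here), which is exactly the parity obstruction of the memo:
the J-record's classes on the tautological ball quotients are (0,1), the dictionary's admissible classes (keyed at `ι₁`) are (1,0).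

References: Hartshorne II Ex. 2.7, II.3 Thm. 3.3; Deligne, *Hodge cycles on abelian varieties* (LNM 900) §1 (`σX`); Serre, GAGA §2;
B. Conrad, Enseign. Math. 58 (2012) Prop. 2.1 ∕ 3.1 (through the tree's `continuous_baseChangeEquiv(_symm)`).
-/

set_option autoImplicit false

noncomputable section
open CategoryTheory CategoryTheory.Limits AlgebraicGeometry Topology
namespace Summit.HodgeConjecture.CorCM.D2Bridge

open Literature.AlgebraicGeometry.Motives
open Literature.AlgebraicTopology.SingularHomology

universe u

/-! ## §1 `Spec σ` over `Spec L` and the twist of `F`-points -/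

section Twist

variable {L F : Type u} [Field L] [Field F] (ι ι' : L →+* F) (σ : F ≃+* F)

/-- The `F`-points of an `L`-scheme `Y` with values in `F` regarded as an `L`-algebra THROUGH `ι` (an abbreviation for the tree's
`AlgPoints Y F` at the instance `ι.toAlgebra`, so that two embeddings can be used side by side). [folklore] -/
abbrev PointsAlong (Y : SchemeOver L) (ι : L →+* F) : Type u :=
  letI := ι.toAlgebra; AlgPoints Y F

/-- `Spec σ : Spec F ⟶ Spec F` as a morphism OVER `Spec L` from `Spec F` (structure map `Spec ι'`) to `Spec F` (structure map
`Spec ι`), for `ι' = σ ∘ ι` (Hartshorne II Ex. 2.7). [folklore] -/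
def specTwist (h : ι' = σ.toRingHom.comp ι) :
    (letI := ι'.toAlgebra; specOver L F) ⟶ (letI := ι.toAlgebra; specOver L F) :=
  letI := ι.toAlgebra
  Over.homMk (Spec.map (CommRingCat.ofHom σ.toRingHom)) (by
    change Spec.map _ ≫ Spec.map (CommRingCat.ofHom ι) = Spec.map (CommRingCat.ofHom ι')
    rw [← Spec.map_comp, ← CommRingCat.ofHom_comp, h])

/-- The underlying scheme morphism of `specTwist` is `Spec σ`. [folklore] -/
@[simp] theorem specTwist_left (h : ι' = σ.toRingHom.comp ι) :
    (specTwist ι ι' σ h).left = Spec.map (CommRingCat.ofHom σ.toRingHom) := rfl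

/-- From `ι' = σ ∘ ι` to `ι = σ⁻¹ ∘ ι'`. [folklore] -/
theorem eq_symm_comp_of_eq_comp (h : ι' = σ.toRingHom.comp ι) : ι = σ.symm.toRingHom.comp ι' := by
  rw [h]; ext x; simp

/-- `Spec σ⁻¹ ≫ Spec σ = 𝟙` over `Spec L`. [folklore] -/
theorem specTwist_symm_comp (h : ι' = σ.toRingHom.comp ι) :
    specTwist ι' ι σ.symm (eq_symm_comp_of_eq_comp ι ι' σ h) ≫ specTwist ι ι' σ h = 𝟙 _ := by
  ext : 1
  change Spec.map (CommRingCat.ofHom σ.symm.toRingHom) ≫ Spec.map (CommRingCat.ofHom σ.toRingHom) =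
    𝟙 (Spec (CommRingCat.of F))
  rw [← Spec.map_comp, ← CommRingCat.ofHom_comp]
  have : σ.symm.toRingHom.comp σ.toRingHom = RingHom.id F := by ext x; simp
  rw [this, CommRingCat.ofHom_id]
  exact Spec.map_id _

variable {ι ι' σ}

/-- **The twist of `F`-points along `σ`**: `P ↦ Spec σ ≫ P`, from points with values in `F` via `ι` to points with values in
`F` via `ι' = σ ∘ ι`.  On coordinates defined over `L` it is `σ` (`eval_twist`).  For `F = ℂ`, `σ = conj` this is complex
conjugation of points, `Y(ℂ)_ι → Y(ℂ)_ῑ` (Deligne 1982 §1). [folklore] -/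
def twist (h : ι' = σ.toRingHom.comp ι) {Y : SchemeOver L} (P : PointsAlong Y ι) : PointsAlong Y ι' :=
  specTwist ι ι' σ h ≫ P

/-- The underlying morphism of a twisted point: `Spec σ ≫ P`. [folklore] -/
@[simp] theorem twist_left (h : ι' = σ.toRingHom.comp ι) {Y : SchemeOver L} (P : PointsAlong Y ι) :
    (twist h P).left = Spec.map (CommRingCat.ofHom σ.toRingHom) ≫ P.left := rfl

/-- Twisting by `σ⁻¹` undoes twisting by `σ`. [folklore] -/
@[simp] theorem twist_twist_symm (h : ι' = σ.toRingHom.comp ι) {Y : SchemeOver L} (P : PointsAlong Y ι) :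
    twist (eq_symm_comp_of_eq_comp ι ι' σ h) (twist h P) = P := by
  change specTwist ι' ι σ.symm _ ≫ (specTwist ι ι' σ h ≫ P) = P
  rw [← Category.assoc, specTwist_symm_comp, Category.id_comp]

/-- Twisting by `σ` undoes twisting by `σ⁻¹`. [folklore] -/
@[simp] theorem twist_symm_twist (h : ι' = σ.toRingHom.comp ι) {Y : SchemeOver L} (Q : PointsAlong Y ι') :
    twist h (twist (eq_symm_comp_of_eq_comp ι ι' σ h) Q) = Q := by
  have h' := eq_symm_comp_of_eq_comp ι ι' σ h
  have e : specTwist ι ι' σ h = specTwist ι ι' σ.symm.symm (eq_symm_comp_of_eq_comp ι' ι σ.symm h') := by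
    ext : 1; rfl
  change specTwist ι ι' σ h ≫ (specTwist ι' ι σ.symm h' ≫ Q) = Q
  rw [e, ← Category.assoc, specTwist_symm_comp, Category.id_comp]

/-- **The twist is a bijection** `Y(F via ι) ≃ Y(F via ι')` (inverse: the twist along `σ⁻¹`). [folklore] -/
def twistEquiv (h : ι' = σ.toRingHom.comp ι) (Y : SchemeOver L) : PointsAlong Y ι ≃ PointsAlong Y ι' where
  toFun := twist h
  invFun := twist (eq_symm_comp_of_eq_comp ι ι' σ h)
  left_inv := twist_twist_symm h
  right_inv := twist_symm_twist h

/-- The twist is natural in `Y`: `twist (P ≫ f) = twist P ≫ f`. [folklore] -/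
theorem twist_comp (h : ι' = σ.toRingHom.comp ι) {Y Y' : SchemeOver L} (P : PointsAlong Y ι) (f : Y ⟶ Y') :
    twist h (Y := Y') (P ≫ f) = twist h P ≫ f := by
  change specTwist ι ι' σ h ≫ (P ≫ f) = (specTwist ι ι' σ h ≫ P) ≫ f
  rw [Category.assoc]

/-- Under Mathlib `Scheme.SpecToEquivOfField`, the twisted point is the same point of `Y` with residue-field embedding
`κ(P.pt) ⟶ F` followed by `σ` (Hartshorne II Ex. 2.7). [folklore] -/
theorem specToEquivOfField_twist (h : ι' = σ.toRingHom.comp ι) {Y : SchemeOver L} (P : PointsAlong Y ι) :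
    Y.left.SpecToEquivOfField F (twist h P).left =
      ⟨(letI := ι.toAlgebra; P.pt), (letI := ι.toAlgebra; P.resHom) ≫ CommRingCat.ofHom σ.toRingHom⟩ := by
  letI := ι.toAlgebra
  apply (Y.left.SpecToEquivOfField F).symm.injective
  rw [Equiv.symm_apply_apply, twist_left]
  simp only [Scheme.SpecToEquivOfField_symm_apply, Spec.map_comp, Category.assoc]
  congr 1
  exact ((Y.left.SpecToEquivOfField F).symm_apply_apply P.left).symm

/-- The twist does not move the underlying point of `Y`. [folklore] -/
theorem pt_twist (h : ι' = σ.toRingHom.comp ι) {Y : SchemeOver L} (P : PointsAlong Y ι) :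
    (letI := ι'.toAlgebra; (twist h P).pt) = (letI := ι.toAlgebra; P.pt) :=
  (Scheme.SpecToEquivOfField_eq_iff.mp (specToEquivOfField_twist h P)).1

/-- Transport of `Scheme.evaluation` along an equality of points (helper; Mathlib `Scheme.residueFieldCongr`). [folklore] -/
private theorem residueFieldCongr_evaluation {X : Scheme.{u}} (U : X.Opens) {x y : X}
    (e : x = y) (hx : x ∈ U) (f : Γ(X, U)) :
    (X.residueFieldCongr e).hom (X.evaluation U x hx f) = X.evaluation U y (e ▸ hx) f := by
  subst e
  rfl

/-- **On values of regular functions the twist is `σ`**: `f(twist P) = σ (f(P))` for `f` a section of `𝒪_Y` (defined over `L`).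
[folklore] -/
theorem eval_twist (h : ι' = σ.toRingHom.comp ι) {Y : SchemeOver L} (P : PointsAlong Y ι) (U : Y.left.Opens)
    (hU : (letI := ι'.toAlgebra; (twist h P).pt) ∈ U) (f : Γ(Y.left, U)) :
    (letI := ι'.toAlgebra; (twist h P).eval U hU f) =
      σ (letI := ι.toAlgebra; P.eval U ((pt_twist h P) ▸ hU) f) := by
  letI := ι.toAlgebra
  obtain ⟨e, he⟩ := Scheme.SpecToEquivOfField_eq_iff.mp (specToEquivOfField_twist h P)
  change (Y.left.SpecToEquivOfField F (twist h P).left).2 _ = _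
  rw [he, CategoryTheory.comp_apply, CategoryTheory.comp_apply]
  change σ (P.resHom _) = σ (P.resHom _)
  congr 2
  exact residueFieldCongr_evaluation U e hU f

/-- The preimage of a sub-basic set under the twist is the sub-basic set for `σ ⁻¹' V`. [folklore] -/
theorem preimage_twist_basicSet (h : ι' = σ.toRingHom.comp ι) {Y : SchemeOver L} (U : Y.left.Opens)
    (f : Γ(Y.left, U)) (V : Set F) :
    (twist h (Y := Y)) ⁻¹' (letI := ι'.toAlgebra; (AlgPoints.basicSet U f V : Set (AlgPoints Y F))) =
      (letI := ι.toAlgebra; (AlgPoints.basicSet U f (σ ⁻¹' V) : Set (AlgPoints Y F))) := by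
  ext P
  simp only [Set.mem_preimage, AlgPoints.basicSet, Set.mem_setOf_eq]
  constructor
  · rintro ⟨hU, hV⟩
    exact ⟨(pt_twist h P) ▸ hU, by rwa [eval_twist h P U hU f] at hV⟩
  · rintro ⟨hU, hV⟩
    refine ⟨(pt_twist h P).symm ▸ hU, ?_⟩
    rw [eval_twist h P U _ f]
    exact hV

/-- **The twist is continuous** for the strong topologies when `σ` is continuous (on coordinates it is `σ`). [folklore] -/
theorem continuous_twist [TopologicalSpace F] (h : ι' = σ.toRingHom.comp ι) (hσ : Continuous σ) (Y : SchemeOver L) :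
    Continuous (twist h (Y := Y)) := by
  letI := ι'.toAlgebra
  refine continuous_generateFrom_iff.mpr ?_
  rintro _ ⟨U, f, V, hV, rfl⟩
  rw [preimage_twist_basicSet]
  letI := ι.toAlgebra
  exact AlgPoints.isOpen_basicSet _ _ (hV.preimage hσ)

/-- **The twist is a homeomorphism** `Y(F via ι) ≃ₜ Y(F via ι')` when `σ` and `σ⁻¹` are continuous. [folklore] -/
def twistHomeomorph [TopologicalSpace F] (h : ι' = σ.toRingHom.comp ι) (hσ : Continuous σ) (hσ' : Continuous σ.symm)
    (Y : SchemeOver L) : PointsAlong Y ι ≃ₜ PointsAlong Y ι' where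
  toEquiv := twistEquiv h Y
  continuous_toFun := continuous_twist h hσ Y
  continuous_invFun := continuous_twist (eq_symm_comp_of_eq_comp ι ι' σ h) hσ' Y

end Twist

/-! ## §2 Naturality of the tree's `X(F) ≃ X_ι(F)` in `X` -/

section BaseChangeNatural

variable {L F : Type u} [Field L] [Field F] (ι : L →+* F)

/-- **`baseChangeEquiv` is natural in the scheme**: for an `L`-morphism `f : Y ⟶ Y'`,
`baseChangeEquiv ι Y' (P ≫ f) = baseChangeEquiv ι Y P ≫ (baseChangeHom ι).map f` (both are the unique point of
`Y' ×_{L,ι} F` over `P ≫ f` and over `Spec F`; universal property of the fibre product, Hartshorne II.3 Thm. 3.3). [folklore] -/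
theorem baseChangeEquiv_comp {Y Y' : SchemeOver L} (P : PointsAlong Y ι) (f : Y ⟶ Y') :
    AlgPoints.baseChangeEquiv ι Y' (P ≫ f) = AlgPoints.baseChangeEquiv ι Y P ≫ (baseChangeHom ι).map f := by
  letI := ι.toAlgebra
  -- `baseChangeEquiv` is `Iso.homCongr` followed by the adjunction `Over.map ⊣ Over.pullback`, which is natural
  change (Over.mapPullbackAdj (Spec.map (CommRingCat.ofHom ι))).homEquiv _ _
      ((AlgPoints.specOverIsoMapObj ι).homCongr (Iso.refl Y') (P ≫ f)) =
    (Over.mapPullbackAdj (Spec.map (CommRingCat.ofHom ι))).homEquiv _ _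
      ((AlgPoints.specOverIsoMapObj ι).homCongr (Iso.refl Y) P) ≫
        (Over.pullback (Spec.map (CommRingCat.ofHom ι))).map f
  rw [← Adjunction.homEquiv_naturality_right]
  congr 1

end BaseChangeNatural

/-! ## §3 Complex points of conjugate base changes are canonically homeomorphic -/

section ConjPoints

variable {L F : Type u} [Field L] [Field F] [TopologicalSpace F] [IsTopologicalDivisionRing F] [T2Space F]
  (ι ι' : L →+* F) (σ : F ≃+* F) (h : ι' = σ.toRingHom.comp ι) (hσ : Continuous σ) (hσ' : Continuous σ.symm)

/-- The tree's bijection `Y(F via ι) ≃ Y_ι(F)` as a homeomorphism (both directions continuous: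
`AlgPoints.continuous_baseChangeEquiv`, `AlgPoints.continuous_baseChangeEquiv_symm` — the content of the tree's
`isHomeomorph_baseChangeEquiv_holds`, repackaged so that the inverse is DEFINITIONALLY `baseChangeEquiv.symm`). [folklore] -/
def baseChangeHomeomorph (Y : SchemeOver L) : PointsAlong Y ι ≃ₜ AlgPoints ((baseChangeHom ι).obj Y) F :=
  letI := ι.toAlgebra
  Homeomorph.mk (AlgPoints.baseChangeEquiv ι Y) (AlgPoints.continuous_baseChangeEquiv ι Y)
    (AlgPoints.continuous_baseChangeEquiv_symm ι Y)

/-- `baseChangeHomeomorph` is `baseChangeEquiv` on points. [folklore] -/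
@[simp]
theorem baseChangeHomeomorph_apply (Y : SchemeOver L) (P : PointsAlong Y ι) :
    baseChangeHomeomorph ι Y P = AlgPoints.baseChangeEquiv ι Y P := rfl

/-- The inverse of `baseChangeHomeomorph` is `baseChangeEquiv.symm` on points. [folklore] -/
@[simp]
theorem baseChangeHomeomorph_symm_apply (Y : SchemeOver L) (Q : AlgPoints ((baseChangeHom ι).obj Y) F) :
    (baseChangeHomeomorph ι Y).symm Q = (letI := ι.toAlgebra; (AlgPoints.baseChangeEquiv ι Y).symm Q) := rfl

/-- **Conjugation transport of points**: the `F`-points of the base changes `Y ×_{L,ι} F` and `Y ×_{L,ι'} F`, `ι' = σ ∘ ι`, are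
canonically homeomorphic — `Y_ι(F) ≃ Y(F via ι) ≃[twist] Y(F via ι') ≃ Y_{ι'}(F)`.  For `F = ℂ`, `σ = conj`: complex conjugation
identifies the complex points of the two complexifications (Deligne 1982 §1; Serre GAGA §2). [folklore] -/
def conjPoints (Y : SchemeOver L) :
    AlgPoints ((baseChangeHom ι).obj Y) F ≃ₜ AlgPoints ((baseChangeHom ι').obj Y) F :=
  ((baseChangeHomeomorph ι Y).symm.trans (twistHomeomorph h hσ hσ' Y)).trans (baseChangeHomeomorph ι' Y)

/-- Formula: `conjPoints Q = baseChangeEquiv ι' (twist (baseChangeEquiv ι)⁻¹ Q)`. [folklore] -/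
theorem conjPoints_apply (Y : SchemeOver L) (Q : AlgPoints ((baseChangeHom ι).obj Y) F) :
    conjPoints ι ι' σ h hσ hσ' Y Q =
      AlgPoints.baseChangeEquiv ι' Y (twist h ((letI := ι.toAlgebra; (AlgPoints.baseChangeEquiv ι Y).symm Q))) := rfl

/-- **Naturality of `conjPoints`** in `Y`: for an `L`-morphism `f : Y ⟶ Y'`,
`conjPoints (Q ≫ f_ι) = conjPoints Q ≫ f_{ι'}` with `f_ι = (baseChangeHom ι).map f`. [folklore] -/
theorem conjPoints_natural {Y Y' : SchemeOver L} (f : Y ⟶ Y') (Q : AlgPoints ((baseChangeHom ι).obj Y) F) :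
    conjPoints ι ι' σ h hσ hσ' Y' (Q ≫ (baseChangeHom ι).map f) =
      conjPoints ι ι' σ h hσ hσ' Y Q ≫ (baseChangeHom ι').map f := by
  letI := ι.toAlgebra
  rw [conjPoints_apply, conjPoints_apply]
  -- move `f` through `(baseChangeEquiv ι)⁻¹`, `twist`, `baseChangeEquiv ι'`
  have h1 : (AlgPoints.baseChangeEquiv ι Y').symm (Q ≫ (baseChangeHom ι).map f) =
      ((AlgPoints.baseChangeEquiv ι Y).symm Q ≫ f : PointsAlong Y' ι) := by
    apply (AlgPoints.baseChangeEquiv ι Y').injective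
    rw [Equiv.apply_symm_apply, baseChangeEquiv_comp ι ((AlgPoints.baseChangeEquiv ι Y).symm Q) f,
      Equiv.apply_symm_apply]
  rw [h1, twist_comp h _ f, baseChangeEquiv_comp ι' _ f]

end ConjPoints

/-! ## §4 `F = ℂ`, `σ = conj`: Betti cohomology of the two complexifications -/

section Betti

variable {L : Type} [Field L] (ι : L →+* ℂ)

/-- `ῑ := conj ∘ ι`, the complex-conjugate embedding (notation of DECISION #13). [folklore] -/
abbrev conjEmb (ι : L →+* ℂ) : L →+* ℂ := (starRingEnd ℂ).comp ι

/-- `ῑ = conj ∘ ι` with `conj` as the ring AUTOMORPHISM `starRingAut` (by `rfl`). [folklore] -/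
theorem conjEmb_eq : conjEmb ι = (starRingAut : ℂ ≃+* ℂ).toRingHom.comp ι := rfl
/-- Complex conjugation is continuous (Mathlib `Complex.continuous_conj`). [folklore] -/
theorem continuous_starRingAut : Continuous (starRingAut : ℂ ≃+* ℂ) := Complex.continuous_conj

/-- The inverse of complex conjugation is complex conjugation, hence continuous. [folklore] -/
theorem continuous_starRingAut_symm : Continuous (starRingAut : ℂ ≃+* ℂ).symm := by
  have : ((starRingAut : ℂ ≃+* ℂ).symm : ℂ → ℂ) = starRingAut := by
    ext z
    exact (starRingAut : ℂ ≃+* ℂ).injective (by simp)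
  rw [this]
  exact Complex.continuous_conj

/-- **Complex conjugation on complex points**: `(Y ×_{L,ι} ℂ)(ℂ) ≃ₜ (Y ×_{L,ῑ} ℂ)(ℂ)`, natural in `Y`. [folklore] -/
def conjComplexPoints (Y : SchemeOver L) :
    ComplexPoints ((baseChangeHom ι).obj Y) ≃ₜ ComplexPoints ((baseChangeHom (conjEmb ι)).obj Y) :=
  conjPoints ι (conjEmb ι) starRingAut (conjEmb_eq ι) (continuous_starRingAut) (continuous_starRingAut_symm) Y

/-- **Betti cohomology of conjugate complexifications**: `Hᵏ((Y ×_{L,ι} ℂ)(ℂ); ℚ) ≅ Hᵏ((Y ×_{L,ῑ} ℂ)(ℂ); ℚ)`, the isomorphism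
induced by complex conjugation of points (pull-back along `conjComplexPoints⁻¹`). [folklore] -/
def bettiConjIso (Y : SchemeOver L) (k : ℕ) :
    bettiCohomology ((baseChangeHom ι).obj Y) k ≅ bettiCohomology ((baseChangeHom (conjEmb ι)).obj Y) k :=
  singularCohomology.mapIso ℚ ℚ (conjComplexPoints ι Y).symm k

/-- **Naturality of `bettiConjIso`**: for an `L`-morphism `f : Y ⟶ Y'` the isomorphisms intertwine the pull-backs along the two
base changes of `f`: `(f_ι)^* ≫ bettiConjIso Y = bettiConjIso Y' ≫ (f_ῑ)^*`. [folklore] -/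
theorem bettiConjIso_natural {Y Y' : SchemeOver L} (f : Y ⟶ Y') (k : ℕ) :
    bettiCohomology.map ((baseChangeHom ι).map f) k ≫ (bettiConjIso ι Y k).hom =
      (bettiConjIso ι Y' k).hom ≫ bettiCohomology.map ((baseChangeHom (conjEmb ι)).map f) k := by
  change singularCohomology.map ℚ ℚ _ k ≫ singularCohomology.map ℚ ℚ _ k =
    singularCohomology.map ℚ ℚ _ k ≫ singularCohomology.map ℚ ℚ _ k
  rw [← singularCohomology.map_comp, ← singularCohomology.map_comp]
  congr 1
  -- the square of continuous maps on points of `Y_ῑ`: `f_ι ∘ conj⁻¹ = conj⁻¹ ∘ f_ῑ`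
  ext Q : 1
  change AlgPoints.map ((baseChangeHom ι).map f) ((conjComplexPoints ι Y).symm Q) =
    (conjComplexPoints ι Y').symm (AlgPoints.map ((baseChangeHom (conjEmb ι)).map f) Q)
  apply (conjComplexPoints ι Y').injective
  rw [Homeomorph.apply_symm_apply, AlgPoints.map_apply, AlgPoints.map_apply]
  have hn := conjPoints_natural ι (conjEmb ι) starRingAut (conjEmb_eq ι) continuous_starRingAut
    continuous_starRingAut_symm f ((conjComplexPoints ι Y).symm Q)
  have hq : conjPoints ι (conjEmb ι) starRingAut (conjEmb_eq ι) continuous_starRingAut continuous_starRingAut_symm Y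
      ((conjComplexPoints ι Y).symm Q) = Q := (conjComplexPoints ι Y).apply_symm_apply Q
  rw [hq] at hn
  exact hn

/-- The `ℚ`-linear form: `Hᵏ((Y ×_{L,ι} ℂ)(ℂ); ℚ) ≃ₗ[ℚ] Hᵏ((Y ×_{L,ῑ} ℂ)(ℂ); ℚ)`. [folklore] -/
def bettiConjLinearEquiv (Y : SchemeOver L) (k : ℕ) :
    bettiCohomology ((baseChangeHom ι).obj Y) k ≃ₗ[ℚ] bettiCohomology ((baseChangeHom (conjEmb ι)).obj Y) k :=
  (bettiConjIso ι Y k).toLinearEquiv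

/-- Naturality in the currency of `BettiUniverse.pull` (`= (bettiCohomology.map _ _).hom`):
`bettiConjLinearEquiv Y ∘ (f_ι)^* = (f_ῑ)^* ∘ bettiConjLinearEquiv Y'`. [folklore] -/
theorem bettiConjLinearEquiv_pull {Y Y' : SchemeOver L} (f : Y ⟶ Y') (k : ℕ)
    (x : bettiCohomology ((baseChangeHom ι).obj Y') k) :
    bettiConjLinearEquiv ι Y k ((bettiCohomology.map ((baseChangeHom ι).map f) k).hom x) =
      (bettiCohomology.map ((baseChangeHom (conjEmb ι)).map f) k).hom (bettiConjLinearEquiv ι Y' k x) := by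
  have := congrArg (fun φ => φ.hom x) (bettiConjIso_natural ι f k)
  simpa [bettiConjLinearEquiv, ModuleCat.comp_apply] using this

end Betti

/-! ## §5 The abelian-variety currency of the J-record ∕ S1 files -/

section AbelianVariety

open Literature.AlgebraicGeometry.Motives.AbelianVariety

variable {L : Type} [Field L] (ι : L →+* ℂ)

/-- Under `letI := ι.toAlgebra`, the underlying `ℂ`-scheme of `A.baseChange ℂ` IS `(baseChangeHom ι).obj A.X` (by `rfl`:
`AbelianVariety.baseChange` is `Over.pullback` along `Spec (algebraMap L ℂ) = Spec ι`). [folklore] -/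
theorem baseChange_X_eq (A : Literature.AlgebraicGeometry.Motives.AbelianVariety L) :
    (letI := ι.toAlgebra; (A.baseChange ℂ).X) = (baseChangeHom ι).obj A.X := rfl

/-- Under `letI := ι.toAlgebra`, the scheme morphism underlying `Hom.baseChange ℂ φ` IS `(baseChangeHom ι).map` of the scheme
morphism underlying `φ` (by `rfl`, `Hom.baseChange_hom_hom_hom`). [folklore] -/
theorem hom_baseChange_eq {A B : Literature.AlgebraicGeometry.Motives.AbelianVariety L} (φ : A ⟶ B) :
    (letI := ι.toAlgebra; (Hom.baseChange ℂ φ).hom.hom.hom) = (baseChangeHom ι).map φ.hom.hom.hom := rfl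

/-- **Conjugation transport for the carriers of the J-record and of S1**: for an abelian variety `A/L`,
`H¹((A ⊗_{L,ι} ℂ)(ℂ); ℚ) ≃ₗ[ℚ] H¹((A ⊗_{L,ῑ} ℂ)(ℂ); ℚ)` (the types `bettiCohomology (A.baseChange ℂ).X 1` under the two instances
`ι.toAlgebra`, `ῑ.toAlgebra`), intertwining the pull-backs along `Hom.baseChange ℂ φ` for every `L`-homomorphism `φ : A ⟶ B` — so the
RATIONAL carriers `U`, `L`, `P` of a `Map43RationalData` built at one instance transport to the other; what does not transport is the
complex structure (the Hodge type is reversed). [folklore] -/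
theorem bettiConjLinearEquiv_pull_baseChange {A B : Literature.AlgebraicGeometry.Motives.AbelianVariety L} (φ : A ⟶ B) (k : ℕ)
    (x : letI := ι.toAlgebra; bettiCohomology (B.baseChange ℂ).X k) :
    bettiConjLinearEquiv ι A.X k
        ((letI := ι.toAlgebra;
          Literature.AlgebraicGeometry.HodgeTheory.BettiUniverse.pull (Hom.baseChange ℂ φ).hom.hom.hom k) x) =
      (letI := (conjEmb ι).toAlgebra;
        Literature.AlgebraicGeometry.HodgeTheory.BettiUniverse.pull (Hom.baseChange ℂ φ).hom.hom.hom k)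
        (bettiConjLinearEquiv ι B.X k x) :=
  bettiConjLinearEquiv_pull ι φ.hom.hom.hom k x

end AbelianVariety

end Summit.HodgeConjecture.CorCM.D2Bridge

end
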